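import Literature.NumberTheory.Automorphic.FuchsianMaassCuspForms

/-!
# Joint eigenvectors of the invariant integral operators on `L²(Γ\ℍ)` are eigenfunctions of `Δ`
(Iwaniec, *Spectral Methods of Automorphic Forms*, GSM 53, §1.8 Thms 1.9, 1.14–1.16, Appendix A.3
Cor. A.9; PDF pp. 21–24, 135–136)

A small brick of the Eisenstein-free proof of the pretrace estimate (12.5)
(`Literature.NumberTheory.Automorphic.Iwaniec2002_eq_12_5`): the regularity step of Theorem 4.7
(`Fuchsian.exists_isMaassCuspForm_of_isJointEigenvector`) WITHOUT the cuspidal condition. For a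
discrete `Γ ≤ SL₂(ℝ)` with `-1 ∈ Γ` and a measurable fundamental domain `F`: a non-zero `v ∈ L²(F)`
which is an eigenvector of every `T_k` (`k` a Lipschitz test kernel) is represented by a continuous
automorphic `C²` solution `u` of `(Δ + 1/4 + t²)u = 0` with real `1/4 + t²`, an eigenfunction of all
invariant integral operators with eigenvalue `h(t)` (`exists_eigenfunction_of_isJointEigenvector`;
proof as in the cuspidal file: a smooth kernel `k₀` with eigenvalue `c₀ ≠ 0`, `u = c₀⁻¹ L_{k₀} v^Γ`,
Theorem 1.9 for `Δu`, reality of `c₀, c₁` by self-adjointness, Theorem 1.16). Conversely such a `u`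
gives `T_k v = h(t) v` in `L²(F)` (`kernelCLM_eq_smul_of_eigenfunction`). In the sequel this turns a
finite-dimensional piece of `L²(F)` invariant under all `T_k` into small eigenfunctions of `Δ`.

Everything here is proved; nothing is vendored; no fact is introduced.

## References
* [Iwaniec2002] H. Iwaniec, *Spectral Methods of Automorphic Forms*, 2nd ed., GSM 53, AMS 2002,
  Thms 1.9, 1.14–1.16, PDF pp. 21–24; Cor. A.9, PDF pp. 135–136
  (held copy `book:iwaniec2002-spectral-methods-automorphic-forms`).
-/

noncomputable section

open MeasureTheory Set Filter Real UpperHalfPlane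
open scoped Topology MatrixGroups ComplexConjugate NNReal ENNReal Pointwise

namespace Literature.NumberTheory.Automorphic

namespace Fuchsian

variable {Γ : Subgroup (GL (Fin 2) ℝ)} {F : Set ℍ}

variable (hΓ : Γ ≤ (Matrix.SpecialLinearGroup.toGL : SL(2, ℝ) →* GL (Fin 2) ℝ).range)
  (hneg : (-1 : GL (Fin 2) ℝ) ∈ Γ) (hd : IsDiscreteSubgroup Γ) (hF : IsHypFundamentalDomain Γ F)
  {k : ℝ → ℝ}

/-- **Square-integrable automorphic eigenfunctions of `Δ` with spectral parameter `t`** (as genuine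
functions): continuous automorphic `C²` solutions of `(Δ + 1/4 + t²)u = 0` which are eigenfunctions
of all invariant integral operators with eigenvalue `h(t)` (Theorem 1.16) and have real
`1/4 + t²`. [cite: Iwaniec2002, Thms 1.14–1.16 & §4.1, PDF pp. 23–24, 48] -/
structure IsDeltaEigenfunction (Γ : Subgroup (GL (Fin 2) ℝ)) (u : ℍ → ℂ) (t : ℂ) : Prop where
  continuous : Continuous u
  automorphic : IsAutomorphic Γ u
  isC2 : IsC2 u
  eigen : ∀ z, hypLaplacian u z + (1 / 4 + t ^ 2) * u z = 0
  eigen_invariantOperator : ∀ k : ℝ → ℝ, IsTestKernel k → ∀ z, invariantOperator k u z = selbergTransform k t * u z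
  real : ∃ μ : ℝ, (1 / 4 : ℂ) + t ^ 2 = μ

include hΓ hneg hd hF in
/-- **Joint eigenvectors are eigenfunctions of `Δ`** (Theorems 1.9, 1.16 and Cor. A.9, without the
cusp condition): a non-zero `v ∈ L²(F)` which is an eigenvector of every `T_k` (`k` a Lipschitz test
kernel) is represented by an `IsDeltaEigenfunction`. [cite: Iwaniec2002, Thms 1.9, 1.16 & Cor. A.9, PDF pp. 21–24, 135–136] -/
theorem exists_eigenfunction_of_isJointEigenvector
    {v : Lp ℂ 2 ((volume : Measure ℍ).restrict F)} (hv0 : v ≠ 0) (hj : IsJointEigenvector hΓ hneg hd hF v) :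
    ∃ (u : ℍ → ℂ) (t : ℂ), IsDeltaEigenfunction Γ u t ∧ u =ᵐ[(volume : Measure ℍ).restrict F] v := by
  set V : ℍ → ℂ := autExt Γ F v with hVdef
  have hVl : LocallyIntegrable V := locallyIntegrable_autExt hΓ hneg hd hF (Lp.memLp v)
  have hVv : V =ᵐ[(volume : Measure ℍ).restrict F] v := autExt_ae_eq_restrict hΓ hneg hd hF (v : ℍ → ℂ)
  have hVaut : IsAutomorphic Γ V := isAutomorphic_autExt (v : ℍ → ℂ)
  -- Step 1: a smooth kernel with non-zero eigenvalue
  obtain ⟨n, δ, hn', hδ, c₀, hc₀, hc₀0⟩ : ∃ (n : ℕ) (δ : ℝ) (hn : (0 : ℝ) < n) (hδ : 0 < δ) (c₀ : ℂ),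
      kernelCLM hΓ hneg hd hF (isTestKernel_stKernel hn hδ.le) (continuous_stKernel n δ) v = c₀ • v ∧ c₀ ≠ 0 := by
    by_contra hcon
    push Not at hcon
    apply hv0
    refine eq_zero_of_forall_kernelCLM_stKernel_eq_zero hΓ hneg hd hF fun n δ hn hδ => ?_
    obtain ⟨L, hL⟩ := exists_lipschitzWith_stKernel hn δ
    obtain ⟨c, hc⟩ := hj _ (isTestKernel_stKernel hn hδ.le) L hL
    have hc0 : c = 0 := hcon n δ hn hδ c hc
    rw [hc0, zero_smul] at hc
    exact hc
  set k₀ := stKernel n δ with hk₀def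
  have hk₀ : IsTestKernel k₀ := isTestKernel_stKernel hn' hδ.le
  have hk₀c : Continuous k₀ := continuous_stKernel n δ
  obtain ⟨L₀, hL₀⟩ := exists_lipschitzWith_stKernel hn' δ
  have hk₀s : ContDiff ℝ 2 k₀ := contDiff_stKernel n δ
  set g := stKernelLap n δ with hgdef
  have hg : IsTestKernel g := isTestKernel_stKernelLap hn' hδ.le
  obtain ⟨M₁, _, hM₁⟩ := hg.eventually_zero
  obtain ⟨L₁, hL₁⟩ := exists_lipschitzWith_stKernelLap hn' δ
  obtain ⟨c₁, hc₁⟩ := hj g hg L₁ hL₁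
  have hc₀' : kernelCLM hΓ hneg hd hF hk₀ hk₀c v = c₀ • v := hc₀
  have hc₀re : ((c₀.re : ℝ) : ℂ) = c₀ := eigenvalue_real hΓ hneg hd hF hk₀ hk₀c hv0 hc₀'
  have hc₁re : ((c₁.re : ℝ) : ℂ) = c₁ := eigenvalue_real hΓ hneg hd hF hg hL₁.continuous hv0 hc₁
  have hE₀ := invariantOperator_autExt_ae_eq hΓ hneg hd hF hk₀ hk₀c hc₀'
  have hE₁ := invariantOperator_autExt_ae_eq hΓ hneg hd hF hg hL₁.continuous hc₁
  -- the good representative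
  set u : ℍ → ℂ := fun z => c₀⁻¹ * invariantOperator k₀ V z with hudef
  have huV : u =ᵐ[volume] V := by
    filter_upwards [hE₀] with z hz
    rw [hudef]; simp only
    rw [hz, ← mul_assoc, inv_mul_cancel₀ hc₀0, one_mul]
  have hucont : Continuous u :=
    continuous_const.mul (continuous_invariantOperator hk₀ hL₀ (fun w hw => stKernel_eq_zero hn' hw) hVl)
  have huaut : IsAutomorphic Γ u := by
    intro γ hγ z
    rw [hudef]; simp only
    congr 1
    rw [← invariantOperator_comp_smul_of_mem_range k₀ V (hΓ hγ) z]
    congr 1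
    funext w
    exact hVaut γ hγ w
  -- Theorem 1.9
  have hk1 : ∀ x, HasDerivAt k₀ (deriv k₀ x) x := fun x =>
    ((hk₀s.differentiable (by norm_num)) x).hasDerivAt
  have hd1 : ContDiff ℝ 1 (deriv k₀) := (contDiff_stKernel n δ (m := 2)).deriv'
  have hk2 : ∀ x, HasDerivAt (deriv k₀) (deriv (deriv k₀) x) x := fun x =>
    ((hd1.differentiable one_ne_zero) x).hasDerivAt
  have h19 := isC2_invariantOperator_and_hypLaplacian hk₀s hk₀ hk1 hk2 hVl
  have huC2 : IsC2 u := h19.1.const_mul c₀⁻¹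
  have hΔu : ∀ z, hypLaplacian u z = c₀⁻¹ * invariantOperator g V z := by
    intro z
    rw [hudef, hypLaplacian_const_mul' h19.1, h19.2 z]
    rfl
  have hgu : ∀ z, invariantOperator g V z = c₁ * u z := by
    have hcont1 : Continuous (invariantOperator g u) :=
      continuous_invariantOperator hg hL₁ hM₁ hucont.locallyIntegrable
    have e1 : invariantOperator g V = invariantOperator g u := funext fun z => invariantOperator_congr_ae huV.symm z
    have e2 : invariantOperator g u =ᵐ[volume] fun z => c₁ * u z := by
      rw [← e1]
      filter_upwards [hE₁, huV] with z hz hzu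
      rw [hz, hzu]
    have e3 : (fun z => invariantOperator g u z - c₁ * u z) = 0 := by
      refine eq_zero_of_continuous_of_ae_eq_zero (hcont1.sub (continuous_const.mul hucont)) ?_
      filter_upwards [e2] with z hz
      rw [Pi.zero_apply, hz, sub_self]
    intro z
    rw [e1]
    have := congrFun e3 z
    rwa [Pi.zero_apply, sub_eq_zero] at this
  -- the spectral parameter
  have hconj₀ : conj c₀ = c₀ := Complex.conj_eq_iff_re.mpr hc₀re
  have hconj₁ : conj c₁ = c₁ := Complex.conj_eq_iff_re.mpr hc₁re
  set μc : ℂ := -(c₀⁻¹ * c₁) with hμc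
  have hμreal : ((μc.re : ℝ) : ℂ) = μc := by
    refine Complex.conj_eq_iff_re.mp ?_
    rw [hμc, map_neg, map_mul, map_inv₀, hconj₀, hconj₁]
  set t : ℂ := (μc - 1 / 4) ^ ((2 : ℕ)⁻¹ : ℂ) with htdef
  have ht : (1 / 4 : ℂ) + t ^ 2 = μc := by
    rw [htdef, Complex.cpow_nat_inv_pow _ two_ne_zero]; ring
  have heig : ∀ z, hypLaplacian u z + (1 / 4 + t ^ 2) * u z = 0 := by
    intro z
    rw [ht, hΔu z, hgu z, hμc]
    field_simp
    ring
  refine ⟨u, t, ⟨hucont, huaut, huC2, heig, fun k hk z => invariantOperator_eigenfunction hk huC2 t heig z,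
    ⟨μc.re, by rw [ht, hμreal]⟩⟩, ?_⟩
  exact Filter.EventuallyEq.trans (ae_restrict_of_ae huV) hVv

include hΓ hneg hd hF in
/-- **`T_k v = h(t) v`** for the class `v ∈ L²(F)` of an `IsDeltaEigenfunction` with spectral
parameter `t` and every continuous test kernel `k` (Theorem 1.16 read in `L²(F)`). [cite: Iwaniec2002, Thm 1.16 & §7.4, PDF pp. 24, 76] -/
theorem kernelCLM_eq_smul_of_eigenfunction (hk : IsTestKernel k) (hkc : Continuous k)
    {v : Lp ℂ 2 ((volume : Measure ℍ).restrict F)} {u : ℍ → ℂ} {t : ℂ} (hu : IsDeltaEigenfunction Γ u t)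
    (huv : u =ᵐ[(volume : Measure ℍ).restrict F] v) :
    kernelCLM hΓ hneg hd hF hk hkc v = selbergTransform k t • v := by
  have h1 : autExt Γ F (v : ℍ → ℂ) =ᵐ[volume] u :=
    (autExt_congr_ae hΓ hneg hd hF huv.symm).trans (autExt_ae_eq_of_isAutomorphic hΓ hneg hd hF hu.automorphic)
  have h2 : ∀ z, kernelOp Γ F k v z = selbergTransform k t * u z := by
    intro z
    rw [kernelOp_eq_invariantOperator hΓ hneg hd hF hk (Lp.memLp v) z, invariantOperator_congr_ae h1 z,
      hu.eigen_invariantOperator k hk z]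
  apply Lp.ext
  have h3 := kernelCLM_coeFn hΓ hneg hd hF hk hkc v
  filter_upwards [h3, Lp.coeFn_smul (selbergTransform k t) v, huv] with z hz hzs hzu
  rw [hzs, Pi.smul_apply, smul_eq_mul, hz, h2 z, hzu]

/-- The square of an `L²(F)` representative is integrable on `F`. [folklore] -/
theorem integrableOn_norm_sq_of_ae_eq {u : ℍ → ℂ} {v : Lp ℂ 2 ((volume : Measure ℍ).restrict F)}
    (huv : u =ᵐ[(volume : Measure ℍ).restrict F] v) : IntegrableOn (fun z => ‖u z‖ ^ 2) F := by
  have hmem : MemLp u 2 ((volume : Measure ℍ).restrict F) := (Lp.memLp v).ae_eq huv.symm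
  exact (memLp_two_iff_integrable_sq_norm hmem.1).1 hmem

/-- A Maass form in the sense of `IsDeltaEigenfunction` with `1/4 + t² ≥ 1/4` has a real spectral
parameter giving the same eigen-relations: if `(1/4 : ℂ) + t² = μ` with `1/4 ≤ μ` then
`t² = (√(μ - 1/4))²` and `h(t) = h(√(μ - 1/4))` for every test kernel (`h` even in `t`, a
function of `t²`). [cite: Iwaniec2002, (1.63) & Thm 1.16, PDF p. 24] -/
theorem selbergTransform_eq_of_sq_eq (k : ℝ → ℝ) {t s : ℂ} (h : t ^ 2 = s ^ 2) :
    selbergTransform k t = selbergTransform k s := by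
  rcases sq_eq_sq_iff_eq_or_eq_neg.mp h with h1 | h1
  · rw [h1]
  · rw [h1, selbergTransform_neg]

end Fuchsian

end Literature.NumberTheory.Automorphic

end
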